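import Summits.QuantumFields.BalabanUV.Beta.EriceRemainderEnclosureHistoryAutonomyThreshold

/-!
# EriceRemainderEnclosureHistoryAutonomyThresholdDiscrete — (E46a) THE THRESHOLD PER GEOMETRY: uniqueness of the box solution of the flow with
# memory holds under the DISCRETE weight condition `M·m·c_m³ ≤ 2` for every SCALE `m ∈ ℕ` (`c_m = (1∕γ² + m·b)^{−1∕2}`) — the supremum over
# INTEGER scales, not over the real variable; (E38a)'s `M·γ ≤ 3√3·b` is its corollary (the real supremum `γ∕(3√3·b)` is attained only at
# `m = 2∕(bγ²)`), and when asymptotic freedom is STRONG relative to the box (`bγ² ≥ 2`) the binding scale is `m = 1` and uniqueness holds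
# whenever `M·γ³ ≤ 2(1 + bγ²)^{3∕2}`, i.e. up to the ratio `M·γ∕b = 2(1+bγ²)^{3∕2}∕(bγ²) ≥ 3√3` (equality iff `bγ² = 2`, the geometry of ALL
# the tree's witnesses — (E38c), (E44c), (E45a)): the ratio `M·γ∕b` alone is sharp over all geometries, not per geometry

Cell `pub-balaban`, β-function sub-cell, BINDER row D4 «RemainderConst leaves for Bałaban's split» (`HOME/BINDER-OWNERS.md`; owner
lineage `b2b-balaban-beta-an4`; this file by co-owner #2 lineage `b2b-balaban-beta-d4-p2`, generation 41), β-FLOW TEAM duty (1),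
FREEZE (0) honoured (def-free; (E38a) `…HistoryAutonomyThreshold` BY NAME — `weight_sharp_le`, `abs_sub_lt_half_cube_mul`, `le_inv_sqrt_of_le_inv_sq`,
`abs_sub_le_invSqrt_of_memFlow`; (E37b) `abs_drive_sub_drive_le_zm`).

HONEST FRAMING (page 1, verbatim and binding).  *"Discharging BetaPertH makes Bałaban's UV stability UNCONDITIONAL — a real
constructive-QFT result; it is NOT the continuum limit and NOT the Clay problem."*  THIS FILE DISCHARGES NOTHING OF THE KIND.  Elementary
real analysis about an ABSTRACT functional with displayed zeroth moment and floor; which modulus ∕ ratio ∕ geometry [I]'s (1.22) limit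
functional has is NOT PRINTED (GAPS G-t4-U2-1∕-2) and not asserted.  Row D4 class UNCHANGED (critical-path width 0; instance 0∕1; D4 DISCHARGE
NO DATE).  HONEST DEPENDENCY: continuum YM on T⁴ ⇐ BetaPertH ∧ nine spine estimates (0/9 proved); BetaPertH ⇐ (D1) ∧ (D4) ∧ CAP+tail; G-an2-4
gates asym, D1 and NE2/3/4.

THE POINT (census sense (α); the AUTONOMY row, the size of the smallness once more).  (E38a)'s proof compares the discrepancy of two box
solutions at the scale `j⋆` where its supremum is ATTAINED with `(j⋆·c_{j⋆}³∕2)·M` times itself, and then bounds `j⋆·c_{j⋆}³∕2` by its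
supremum over the REAL variable, `γ∕(3√3·b)` (`weight_sharp_le`, attained at `m·b = 2∕γ²`).  But `j⋆` is an INTEGER: the condition the
argument needs is only `M·(m·c_m³∕2) ≤ 1` for every `m ∈ ℕ` (§1 `memFlow_unique_of_discrete_weight`).  (E38a) is the corollary
`discreteWeight_of_ratio_le`; the (E38c)∕(E45a) witnesses live at `bγ² = 2`, where the real maximiser `m = 2∕(bγ²) = 1` IS an integer, so over
ALL geometries the ratio constant `3√3` stays exact — but at a FIXED geometry `s = bγ²` the exact condition is the discrete one.  §2 makes
the gain explicit where it is cleanest: for `s ≥ 2` the weight `m ↦ m·c_m³` is NON-INCREASING on `m ≥ 1` (`u ↦ u∕(1+u)^{3∕2}` decreases on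
`[2,∞[`; `s²(1+u)³ − u²(1+s)³ = t·s(1+s)²(s−2) + t²(1+s)(2s²−2s−1) + s²t³ ≥ 0` for `u = s + t`), so the binding scale is `m = 1` and uniqueness
holds under `M·γ³ ≤ 2(1 + bγ²)^{3∕2}` (`memFlow_unique_of_strongAF`) — in ratio form `M·γ∕b ≤ 2(1+s)^{3∕2}∕s`, which exceeds `3√3` for every
`s > 2` (`ratio_threshold_gt`: e.g. `27∕4` at `s = 8`).  So STRONG asymptotic freedom relative to the box RAISES the uniqueness threshold:
the sharp invariant is the pair `(M·γ∕b, bγ²)`, not the ratio alone.  Sharpness per geometry: for `s ≥ 2` (binding scale `1`) the sequel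
(E46b) `…HistoryAutonomyThresholdDiscreteWitness` gives a Markov tent family with two box solutions at every `M·γ³ > 2(1+s)^{3∕2}` — EXACT;
for `s < 2` the binding INTEGER scale can be `m ≥ 2` (it is as soon as `(1+2s)³ < 4(1+s)³`, i.e. `s < s₁ ≈ 1.42`; for `s ∈ [s₁, 2[` it is
still `m = 1`, covered by `memFlow_unique_of_discrete_weight` though not by §2's monotonicity proof), and at a binding scale `m ≥ 2` the
factor `m` of the weight counts `m` drive terms that a MARKOV functional cannot all activate (only the term at the branching scale differs),
so a sharp witness there needs genuine memory — OPEN, and said so.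

WHAT IS PROVED ([folklore]; 0 `def`, 0 sorry).
 §1 **`memFlow_unique_of_discrete_weight`** (`∀ m, M·(m·c_m³∕2) ≤ 1` ⟹ two box solutions from one pin coincide; no sign condition on `M` is
    needed), `discreteWeight_of_ratio_le` ((E38a)'s hypothesis `M·γ ≤ 3√3·b` implies the discrete one, so (E38a) `memFlow_unique_zs_closed` is the
    corollary — not restated).
 §2 `cube_compare` (the polynomial identity∕inequality), `weight_fun_antitone` (`u∕((1+u)√(1+u))` non-increasing on `[2,∞[`), `inv_sqrt_cube_eq`,
    `weight_le_first_weight` (`s ≥ 2 ⟹ m·c_m³ ≤ c_1³` for `m ≥ 1`), **`discreteWeight_of_strongAF`**, **`memFlow_unique_of_strongAF`**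
    (`bγ² ≥ 2`, `M·γ³ ≤ 2(1+bγ²)√(1+bγ²)` ⟹ unique), **`ratio_threshold_gt`** (`s > 2 ⟹ 3√3 < 2(1+s)√(1+s)∕s`), `ratio_threshold_at_eight` (`= 27∕4`).
-/

noncomputable section
open Filter Topology Finset

namespace Summit.QuantumFields.BalabanUV.Beta.EriceRemainderEnclosureHistoryAutonomyThresholdDiscrete

open Literature.MathematicalPhysics.QuantumFieldTheory.Balaban1983to89
open Literature.MathematicalPhysics.QuantumFieldTheory.Balaban1983to89.T4BetaStationary
open Literature.MathematicalPhysics.QuantumFieldTheory.Balaban1983to89.T4BetaFlowWellPosed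
open Summit.QuantumFields.BalabanUV.Beta.EriceRemainderEnclosureHistoryAutonomyWellPosed
open Summit.QuantumFields.BalabanUV.Beta.EriceRemainderEnclosureHistoryAutonomyThreshold

variable {B : (ℕ → ℝ) → ℝ} {M γ b gIR : ℝ} {h h' : ℕ → ℝ}

/-! ## §1 Uniqueness under the discrete weight condition -/

/-- **UNIQUENESS UNDER THE DISCRETE WEIGHT CONDITION.**  Zeroth moment `M`, floor `b > 0` on ]0,γ], pin `gIR ∈ ]0,γ]`; if at EVERY SCALE
`m ∈ ℕ` the weight satisfies `M·(m·c_m³∕2) ≤ 1`, `c_m = (1∕γ² + m·b)^{−1∕2}`, then two box solutions from that pin coincide.  (E38a)'s proof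
verbatim, with the real supremum `γ∕(3√3·b)` of the weight replaced by its value at the integer scale where the discrepancy is largest.
[folklore] -/
theorem memFlow_unique_of_discrete_weight
    (hB : ∀ u u' : ℕ → ℝ, SeqBox γ u → SeqBox γ u' → ∀ D : ℝ, (∀ j, |u j - u' j| ≤ D) → |B u - B u'| ≤ M * D)
    (hgIR : 0 < gIR) (hgIRγ : gIR ≤ γ) (hb : 0 < b) (hlo : ∀ u, SeqBox γ u → b ≤ B u)
    (hW : ∀ m : ℕ, M * ((m : ℝ) * ((1 / Real.sqrt (1 / γ ^ 2 + (m : ℝ) * b)) ^ 3 / 2)) ≤ 1)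
    (hh : SeqBox γ h) (hh' : SeqBox γ h') (hf : MemFlow B gIR h) (hf' : MemFlow B gIR h') : h = h' := by
  have hγ : 0 < γ := lt_of_lt_of_le hgIR hgIRγ
  by_contra hne
  obtain ⟨j₀, hj₀⟩ : ∃ j, h j ≠ h' j := Function.ne_iff.mp hne
  set δ : ℕ → ℝ := fun j => |h j - h' j| with hδ
  have hδ0 : 0 < δ j₀ := abs_pos.2 (sub_ne_zero.2 hj₀)
  have henv : ∀ j, δ j ≤ 1 / Real.sqrt (1 / gIR ^ 2 + (j : ℝ) * b) := fun j =>
    abs_sub_le_invSqrt_of_memFlow hb hgIR hlo hlo hh hh' hf hf' j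
  obtain ⟨J, hJ⟩ : ∃ J : ℕ, 1 / (b * δ j₀ ^ 2) < J := exists_nat_gt _
  have hfar : ∀ j, J < j → δ j < δ j₀ := by
    intro j hj
    have hjb : 1 / δ j₀ ^ 2 < (j : ℝ) * b := by
      have h1 : 1 / (b * δ j₀ ^ 2) < (j : ℝ) := hJ.trans (by exact_mod_cast hj)
      rw [div_lt_iff₀ (by positivity)] at h1
      rw [div_lt_iff₀ (by positivity)]
      linarith
    have hP : 1 / δ j₀ ^ 2 < 1 / gIR ^ 2 + (j : ℝ) * b := lt_of_lt_of_le hjb (le_add_of_nonneg_left (by positivity))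
    have hlt : 1 / Real.sqrt (1 / gIR ^ 2 + (j : ℝ) * b) < δ j₀ := by
      rw [div_lt_iff₀ (Real.sqrt_pos.2 (lt_trans (by positivity) hP)), ← div_lt_iff₀' hδ0]
      rw [show 1 / δ j₀ = Real.sqrt (1 / δ j₀ ^ 2) by rw [← one_div_pow, Real.sqrt_sq (by positivity)]]
      exact Real.sqrt_lt_sqrt (by positivity) hP
    exact (henv j).trans_lt hlt
  have hj₀J : j₀ ≤ J := not_lt.1 fun hlt => lt_irrefl _ (hfar j₀ hlt)
  obtain ⟨jS, hjS, hmax⟩ := exists_max_image (range (J + 1)) δ ⟨0, by simp⟩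
  have hΔ : ∀ j, δ j ≤ δ jS := by
    intro j
    by_cases hj : j ≤ J
    · exact hmax j (mem_range.2 (Nat.lt_succ_of_le hj))
    · exact (hfar j (not_le.1 hj)).le.trans (hmax j₀ (mem_range.2 (Nat.lt_succ_of_le hj₀J)))
  have hΔpos : 0 < δ jS := hδ0.trans_le (hΔ j₀)
  have hneS : h jS ≠ h' jS := fun e => by simp [hδ, e] at hΔpos
  set P : ℝ := 1 / γ ^ 2 + (jS : ℝ) * b with hP
  have hmb : (0 : ℝ) ≤ (jS : ℝ) * b := mul_nonneg (Nat.cast_nonneg jS) hb.le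
  have hP0 : 0 < P := by positivity
  have hpin : 1 / γ ^ 2 ≤ 1 / gIR ^ 2 := one_div_le_one_div_of_le (by positivity) (pow_le_pow_left₀ hgIR.le hgIRγ 2)
  have hSa : 1 / h jS ^ 2 = 1 / gIR ^ 2 + drive B h jS := invSq_eq_of_memFlow hf jS
  have hSa' : 1 / h' jS ^ 2 = 1 / gIR ^ 2 + drive B h' jS := invSq_eq_of_memFlow hf' jS
  have haP : P ≤ 1 / h jS ^ 2 := by rw [hSa]; exact add_le_add hpin (mul_lower_le_drive hlo hh jS)
  have ha'P : P ≤ 1 / h' jS ^ 2 := by rw [hSa']; exact add_le_add hpin (mul_lower_le_drive hlo hh' jS)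
  set C : ℝ := 1 / Real.sqrt P with hC
  have haC : h jS ≤ C := le_inv_sqrt_of_le_inv_sq (hh jS).1 hP0 haP
  have ha'C : h' jS ≤ C := le_inv_sqrt_of_le_inv_sq (hh' jS).1 hP0 ha'P
  have hstrict := abs_sub_lt_half_cube_mul (hh jS).1 (hh' jS).1 haC ha'C hneS
  have h0 : ∀ u, SeqBox γ u → |B u - B u| ≤ 0 := fun u _ => by simp
  have hdiff : |1 / h jS ^ 2 - 1 / h' jS ^ 2| ≤ (jS : ℝ) * (M * δ jS + 0) := by
    rw [hSa, hSa', show 1 / gIR ^ 2 + drive B h jS - (1 / gIR ^ 2 + drive B h' jS) = drive B h jS - drive B h' jS by ring]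
    exact abs_drive_sub_drive_le_zm hB h0 hh hh' hΔ jS
  have hWj : M * ((jS : ℝ) * (C ^ 3 / 2)) ≤ 1 := hW jS
  have key : δ jS < δ jS := by
    calc δ jS = |h jS - h' jS| := rfl
      _ < C ^ 3 / 2 * |1 / h jS ^ 2 - 1 / h' jS ^ 2| := hstrict
      _ ≤ C ^ 3 / 2 * ((jS : ℝ) * (M * δ jS + 0)) := mul_le_mul_of_nonneg_left hdiff (by positivity)
      _ = M * ((jS : ℝ) * (C ^ 3 / 2)) * δ jS := by ring
      _ ≤ 1 * δ jS := mul_le_mul_of_nonneg_right hWj hΔpos.le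
      _ = δ jS := one_mul _
  exact lt_irrefl _ key

/-- (E38a)'s RATIO CONDITION IMPLIES THE DISCRETE ONE: `M·γ ≤ 3√3·b ⟹ ∀ m, M·(m·c_m³∕2) ≤ 1` (`weight_sharp_le`). [folklore] -/
theorem discreteWeight_of_ratio_le (hM : 0 ≤ M) (hγ : 0 < γ) (hb : 0 < b) (hsmall : M * γ ≤ 3 * Real.sqrt 3 * b) (m : ℕ) :
    M * ((m : ℝ) * ((1 / Real.sqrt (1 / γ ^ 2 + (m : ℝ) * b)) ^ 3 / 2)) ≤ 1 := by
  have h1 := weight_sharp_le hγ hb m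
  have hratio : M * (γ / (3 * Real.sqrt 3 * b)) ≤ 1 := by
    rw [← mul_div_assoc, div_le_one (by positivity)]; exact hsmall
  exact (mul_le_mul_of_nonneg_left h1 hM).trans hratio

/-! ## §2 Strong asymptotic freedom (`bγ² ≥ 2`): the binding scale is `m = 1` -/

/-- THE POLYNOMIAL COMPARISON: for `2 ≤ s ≤ u`, `u²(1+s)³ ≤ s²(1+u)³`
(`s²(1+u)³ − u²(1+s)³ = t·s(1+s)²(s−2) + t²(1+s)(2s²−2s−1) + s²t³`, `t = u − s`). [folklore] -/
theorem cube_compare {s u : ℝ} (hs : 2 ≤ s) (hsu : s ≤ u) : u ^ 2 * (1 + s) ^ 3 ≤ s ^ 2 * (1 + u) ^ 3 := by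
  obtain ⟨t, ht, rfl⟩ : ∃ t, 0 ≤ t ∧ u = s + t := ⟨u - s, sub_nonneg.2 hsu, by ring⟩
  have e : s ^ 2 * (1 + (s + t)) ^ 3 - (s + t) ^ 2 * (1 + s) ^ 3
      = t * (s * (1 + s) ^ 2 * (s - 2)) + t ^ 2 * ((1 + s) * (2 * s ^ 2 - 2 * s - 1)) + s ^ 2 * t ^ 3 := by ring
  have h1 : 0 ≤ t * (s * (1 + s) ^ 2 * (s - 2)) := mul_nonneg ht (mul_nonneg (by positivity) (by linarith))
  have h2 : 0 ≤ t ^ 2 * ((1 + s) * (2 * s ^ 2 - 2 * s - 1)) := mul_nonneg (sq_nonneg t) (mul_nonneg (by linarith) (by nlinarith))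
  have h3 : 0 ≤ s ^ 2 * t ^ 3 := by positivity
  nlinarith [e, h1, h2, h3]

/-- THE WEIGHT FUNCTION `u ↦ u∕((1+u)√(1+u))` IS NON-INCREASING ON `[2, ∞[`. [folklore] -/
theorem weight_fun_antitone {s u : ℝ} (hs : 2 ≤ s) (hsu : s ≤ u) :
    u / ((1 + u) * Real.sqrt (1 + u)) ≤ s / ((1 + s) * Real.sqrt (1 + s)) := by
  have hs0 : 0 < s := by linarith
  have hu0 : 0 < u := by linarith
  rw [div_le_div_iff₀ (by positivity) (by positivity)]
  -- compare squares: (u(1+s)√(1+s))² = u²(1+s)³ ≤ s²(1+u)³ = (s(1+u)√(1+u))²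
  have hsq : (u * ((1 + s) * Real.sqrt (1 + s))) ^ 2 ≤ (s * ((1 + u) * Real.sqrt (1 + u))) ^ 2 := by
    have e1 : (u * ((1 + s) * Real.sqrt (1 + s))) ^ 2 = u ^ 2 * (1 + s) ^ 3 := by
      rw [mul_pow, mul_pow, Real.sq_sqrt (by linarith)]; ring
    have e2 : (s * ((1 + u) * Real.sqrt (1 + u))) ^ 2 = s ^ 2 * (1 + u) ^ 3 := by
      rw [mul_pow, mul_pow, Real.sq_sqrt (by linarith)]; ring
    rw [e1, e2]; exact cube_compare hs hsu
  exact (pow_le_pow_iff_left₀ (by positivity) (by positivity) two_ne_zero).1 hsq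

/-- THE WEIGHT IN THE GEOMETRY VARIABLE `s = bγ²`: `(1∕√(1∕γ² + m·b))³ = γ³∕((1 + m·s)√(1 + m·s))`. [folklore] -/
theorem inv_sqrt_cube_eq (hγ : 0 < γ) (hb : 0 < b) (m : ℕ) :
    (1 / Real.sqrt (1 / γ ^ 2 + (m : ℝ) * b)) ^ 3 = γ ^ 3 / ((1 + (m : ℝ) * (b * γ ^ 2)) * Real.sqrt (1 + (m : ℝ) * (b * γ ^ 2))) := by
  have hms : 0 ≤ (m : ℝ) * (b * γ ^ 2) := by positivity
  have hQ : 0 < 1 + (m : ℝ) * (b * γ ^ 2) := by positivity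
  have e1 : 1 / γ ^ 2 + (m : ℝ) * b = (1 + (m : ℝ) * (b * γ ^ 2)) / γ ^ 2 := by field_simp
  rw [e1, Real.sqrt_div' _ (sq_nonneg γ), Real.sqrt_sq hγ.le, one_div_div, div_pow, pow_succ (Real.sqrt _) 2, Real.sq_sqrt hQ.le]

/-- **FOR `bγ² ≥ 2` THE FIRST SCALE BINDS**: `m·c_m³ ≤ c_1³` for every `m ≥ 1`. [folklore] -/
theorem weight_le_first_weight (hγ : 0 < γ) (hb : 0 < b) (hs : 2 ≤ b * γ ^ 2) {m : ℕ} (hm : 1 ≤ m) :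
    (m : ℝ) * (1 / Real.sqrt (1 / γ ^ 2 + (m : ℝ) * b)) ^ 3 ≤ (1 / Real.sqrt (1 / γ ^ 2 + ((1 : ℕ) : ℝ) * b)) ^ 3 := by
  set s : ℝ := b * γ ^ 2 with hsdef
  have hs0 : 0 < s := by positivity
  have hm' : (1 : ℝ) ≤ m := by exact_mod_cast hm
  rw [inv_sqrt_cube_eq hγ hb m, inv_sqrt_cube_eq hγ hb 1, Nat.cast_one, one_mul]
  have h1 := weight_fun_antitone hs (le_mul_of_one_le_left hs0.le hm' : s ≤ (m : ℝ) * s)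
  -- `m·γ³∕((1+ms)√(1+ms)) = (γ³∕s)·(ms∕((1+ms)√(1+ms))) ≤ (γ³∕s)·(s∕((1+s)√(1+s))) = γ³∕((1+s)√(1+s))`
  have e1 : (m : ℝ) * (γ ^ 3 / ((1 + (m : ℝ) * s) * Real.sqrt (1 + (m : ℝ) * s)))
      = γ ^ 3 / s * ((m : ℝ) * s / ((1 + (m : ℝ) * s) * Real.sqrt (1 + (m : ℝ) * s))) := by
    field_simp
  have e2 : γ ^ 3 / ((1 + s) * Real.sqrt (1 + s)) = γ ^ 3 / s * (s / ((1 + s) * Real.sqrt (1 + s))) := by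
    field_simp
  rw [e1, e2]
  exact mul_le_mul_of_nonneg_left h1 (by positivity)

/-- **THE DISCRETE WEIGHT CONDITION FROM STRONG ASYMPTOTIC FREEDOM**: `bγ² ≥ 2` and `M·γ³ ≤ 2(1 + bγ²)√(1 + bγ²)` give `M·(m·c_m³∕2) ≤ 1` at
every scale. [folklore] -/
theorem discreteWeight_of_strongAF (hM : 0 ≤ M) (hγ : 0 < γ) (hb : 0 < b) (hs : 2 ≤ b * γ ^ 2)
    (hMs : M * γ ^ 3 ≤ 2 * ((1 + b * γ ^ 2) * Real.sqrt (1 + b * γ ^ 2))) (m : ℕ) :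
    M * ((m : ℝ) * ((1 / Real.sqrt (1 / γ ^ 2 + (m : ℝ) * b)) ^ 3 / 2)) ≤ 1 := by
  rcases Nat.eq_zero_or_pos m with rfl | hm
  · simp
  · have h1 := weight_le_first_weight hγ hb hs (Nat.one_le_iff_ne_zero.2 hm.ne')
    have hQ : 0 < (1 + b * γ ^ 2) * Real.sqrt (1 + b * γ ^ 2) := by positivity
    have e1 : (1 / Real.sqrt (1 / γ ^ 2 + ((1 : ℕ) : ℝ) * b)) ^ 3 = γ ^ 3 / ((1 + b * γ ^ 2) * Real.sqrt (1 + b * γ ^ 2)) := by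
      rw [inv_sqrt_cube_eq hγ hb 1, Nat.cast_one, one_mul]
    calc M * ((m : ℝ) * ((1 / Real.sqrt (1 / γ ^ 2 + (m : ℝ) * b)) ^ 3 / 2))
        = M / 2 * ((m : ℝ) * (1 / Real.sqrt (1 / γ ^ 2 + (m : ℝ) * b)) ^ 3) := by ring
      _ ≤ M / 2 * (γ ^ 3 / ((1 + b * γ ^ 2) * Real.sqrt (1 + b * γ ^ 2))) := by
          rw [← e1]; exact mul_le_mul_of_nonneg_left h1 (by positivity)
      _ = M * γ ^ 3 / (2 * ((1 + b * γ ^ 2) * Real.sqrt (1 + b * γ ^ 2))) := by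
          field_simp
      _ ≤ 1 := by rw [div_le_one (by positivity)]; exact hMs

/-- **UNIQUENESS FROM STRONG ASYMPTOTIC FREEDOM**: zeroth moment `M`, floor `b > 0` on ]0,γ], pin in ]0,γ], `bγ² ≥ 2` and
`M·γ³ ≤ 2(1 + bγ²)√(1 + bγ²)` ⟹ two box solutions coincide — in ratio form `M·γ∕b ≤ 2(1+bγ²)^{3∕2}∕(bγ²)`, which is `3√3` at `bγ² = 2` and
LARGER beyond (`ratio_threshold_gt`). [folklore] -/
theorem memFlow_unique_of_strongAF
    (hB : ∀ u u' : ℕ → ℝ, SeqBox γ u → SeqBox γ u' → ∀ D : ℝ, (∀ j, |u j - u' j| ≤ D) → |B u - B u'| ≤ M * D)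
    (hM : 0 ≤ M) (hgIR : 0 < gIR) (hgIRγ : gIR ≤ γ) (hb : 0 < b) (hlo : ∀ u, SeqBox γ u → b ≤ B u)
    (hs : 2 ≤ b * γ ^ 2) (hMs : M * γ ^ 3 ≤ 2 * ((1 + b * γ ^ 2) * Real.sqrt (1 + b * γ ^ 2)))
    (hh : SeqBox γ h) (hh' : SeqBox γ h') (hf : MemFlow B gIR h) (hf' : MemFlow B gIR h') : h = h' :=
  memFlow_unique_of_discrete_weight hB hgIR hgIRγ hb hlo
    (discreteWeight_of_strongAF hM (lt_of_lt_of_le hgIR hgIRγ) hb hs hMs) hh hh' hf hf'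

/-- **THE GAIN OVER `3√3`**: for `s > 2`, `3√3 < 2(1+s)√(1+s)∕s` — at every geometry `bγ² > 2` the uniqueness threshold in the ratio `M·γ∕b`
exceeds (E38a)'s universal constant (`27s² < 4(1+s)³ ⟺ (s−2)²(4s+1) > 0`). [folklore] -/
theorem ratio_threshold_gt {s : ℝ} (hs : 2 < s) : 3 * Real.sqrt 3 < 2 * ((1 + s) * Real.sqrt (1 + s)) / s := by
  have hs0 : 0 < s := by linarith
  rw [lt_div_iff₀ hs0]
  have hsq : (3 * Real.sqrt 3 * s) ^ 2 < (2 * ((1 + s) * Real.sqrt (1 + s))) ^ 2 := by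
    have e1 : (3 * Real.sqrt 3 * s) ^ 2 = 27 * s ^ 2 := by
      rw [mul_pow, mul_pow, Real.sq_sqrt (by norm_num : (0 : ℝ) ≤ 3)]; ring
    have e2 : (2 * ((1 + s) * Real.sqrt (1 + s))) ^ 2 = 4 * (1 + s) ^ 3 := by
      rw [mul_pow, mul_pow, Real.sq_sqrt (by linarith)]; ring
    rw [e1, e2]
    nlinarith [mul_pos (mul_pos (sub_pos.2 hs) (sub_pos.2 hs)) (by linarith : (0 : ℝ) < 4 * s + 1)]
  exact (pow_lt_pow_iff_left₀ (by positivity) (by positivity) two_ne_zero).1 hsq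

/-- A NUMBER: at `bγ² = 8` the ratio threshold is `2·9·3∕8 = 27∕4 = 6.75 > 3√3 ≈ 5.196`. [folklore] -/
theorem ratio_threshold_at_eight : 2 * ((1 + (8 : ℝ)) * Real.sqrt (1 + 8)) / 8 = 27 / 4 := by
  have h9 : Real.sqrt (1 + 8) = 3 := by
    rw [show (1 : ℝ) + 8 = 3 ^ 2 by norm_num, Real.sqrt_sq (by norm_num)]
  rw [h9]; norm_num

end Summit.QuantumFields.BalabanUV.Beta.EriceRemainderEnclosureHistoryAutonomyThresholdDiscrete

end
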